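import Mathlib
import HarnessLib
import Summits.HubbardSuperconductivity.HubbardSuperconductivity.Theorems.KLProgrammeFermiSurfaceEnvelope

/-!
# Route `KLProgramme` (cruxes K3/K1): the Fermi-surface numbers on the two windows, and no nesting

Cell `gate-hubbard-kl`, risk-register item r2; continues `KLProgrammeFermiSurfaceEnvelope.lean` (closed-form
envelopes for `ε(k) = -2 (cos k₁ + cos k₂)`). Here:

* §5 **no nesting**: the `Q = (π, π)` nesting defect on the Fermi curve is `|ε(k + Q) - μ| = 2|μ|`
  (`klfs_nesting_defect`), and parallel gradients at two points of the band curve force `p(φ) = ± p(θ)`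
  (`klfs_parallel_gradients`, from the tree's Gauss-map injectivity `exists_eq_add_int_mul_pi_of_cross_eq_zero`
  — the non-nesting hypothesis of FST I implied by A3);
* §6 the **numbers**: on the certified window `μ ∈ [-0.4267, -0.1798]` (the image of `δ ∈ [0.10, 0.20]`):
  `v_F = ‖∇ε‖ ≥ 0.8287` (true min `0.82877`), `0.0317 ≤ κ ≤ 2.414` (true `0.03182 … 2.4132`), nesting
  defect `≥ 0.3596`; on the analysis window `[-1, -0.15]` of K1/K3: `v_F ≥ 0.7599`, `κ ≥ 0.026`.
  The free curve is `≈ 76×` flatter at the node than at the antinode at `μ = -0.1798` — the r2 datum the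
  sector-counting constants (`h_min ∝ v_F κ`) inherit.

No definitions; everything PROVED. [folklore]
-/

noncomputable section

open Real Set

-- the tree's namespace `Summit.<Summit>.<Problem>.Theorems` repeats the summit name by design (D-0017)
set_option linter.dupNamespace false

namespace Summit.HubbardSuperconductivity.HubbardSuperconductivity.Theorems

open Literature.MathematicalPhysics.QuantumLattice

/-! ### §5 No nesting -/

/-- `ε(k + (π, π)) = -ε(k)`. [folklore] -/
theorem klfs_sqDispersion_add_pi (k : Fin 2 → ℝ) : sqDispersion (fun i => k i + π) = -sqDispersion k := by
  simp [sqDispersion, Real.cos_add_pi]; ring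

/-- **Nesting defect at `Q = (π, π)`**: on the Fermi curve `ε(k) = μ` one has `ε(k + Q) - μ = -2μ`, so
`|ε(k + Q) - μ| = 2|μ|` — the curve and its `Q`-translate are disjoint level sets a fixed energy `2|μ|`
apart (perfect nesting only at half filling `μ = 0`). [folklore] -/
theorem klfs_nesting_defect {μ : ℝ} {k : Fin 2 → ℝ} (hk : sqDispersion k = μ) :
    |sqDispersion (fun i => k i + π) - μ| = 2 * |μ| := by
  rw [klfs_sqDispersion_add_pi, hk, show -μ - μ = -2 * μ by ring, abs_mul, abs_neg]
  norm_num

/-- **No nesting (Gauss map)**: if the gradients `∇ε = 2 (sin x, sin y)` at two points `p(θ), p(φ)` of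
the band curve are parallel, then `p(φ) = ± p(θ)` — restated from the tree's
`exists_eq_add_int_mul_pi_of_cross_eq_zero` (injectivity of the Gauss map modulo the antipode; this is
the non-nesting hypothesis of FST I implied by A3). [folklore] -/
theorem klfs_parallel_gradients {μ : ℝ} (hμ₁ : -4 < μ) (hμ₂ : μ < 0) {θ φ : ℝ}
    (h : Real.sin (bandX μ θ) * Real.sin (bandY μ φ) - Real.sin (bandY μ θ) * Real.sin (bandX μ φ) = 0) :
    ∃ σ : ℝ, (σ = 1 ∨ σ = -1) ∧ bandX μ φ = σ * bandX μ θ ∧ bandY μ φ = σ * bandY μ θ := by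
  obtain ⟨j, hj⟩ := exists_eq_add_int_mul_pi_of_cross_eq_zero hμ₁ hμ₂ h
  obtain ⟨σ, hσ, hX, hY, -, -⟩ := BandSectorCounting.band_add_int_mul_pi hμ₁ hμ₂ θ j
  exact ⟨σ, hσ, by rw [hj, hX], by rw [hj, hY]⟩

/-! ### §6 The numbers on the two windows -/

/-- The certified window `μ ∈ [-0.4267, -0.1798]` (image of `δ ∈ [0.10, 0.20]`) lies in `(-2, 0)`. [folklore] -/
theorem klfs_window_sub {μ : ℝ} (hμ : μ ∈ Icc (-0.4267 : ℝ) (-0.1798)) : -2 < μ ∧ μ < 0 :=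
  ⟨by linarith [hμ.1], by linarith [hμ.2]⟩

/-- The analysis window `μ ∈ [-1, -0.15]` of K1/K3 lies in `(-2, 0)`. [folklore] -/
theorem klfs_analysisWindow_sub {μ : ℝ} (hμ : μ ∈ Icc (-1 : ℝ) (-0.15)) : -2 < μ ∧ μ < 0 :=
  ⟨by linarith [hμ.1], by linarith [hμ.2]⟩

/-- **`v_F ≥ 0.8287` on the certified window**: for `μ ∈ [-0.4267, -0.1798]` and any point of the level
curve, `2 √(sin² x + sin² y) ≥ 0.8287` (true minimum `√(0.1798 · 3.8202) = 0.82877…` at the antinode of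
`μ = -0.1798`). [folklore] -/
theorem klfs_window_fermiSpeed_ge {μ x y : ℝ} (hμ : μ ∈ Icc (-0.4267 : ℝ) (-0.1798))
    (h : -2 * (Real.cos x + Real.cos y) = μ) : 0.8287 ≤ 2 * Real.sqrt (Real.sin x ^ 2 + Real.sin y ^ 2) := by
  have hI := (klfs_fermiSpeedSq_mem_Icc h).1
  have hμ2 : (0.8287 : ℝ) ^ 2 ≤ -μ * (4 + μ) := by
    nlinarith [mul_nonpos_iff.2 (Or.inl ⟨sub_nonneg.2 hμ.1, sub_nonpos.2 hμ.2⟩), hμ.1, hμ.2]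
  rw [klfs_two_mul_sqrt]
  exact Real.le_sqrt_of_sq_le (hμ2.trans hI)

/-- The same in `KohnLuttinger` vocabulary: `‖∇ε(k)‖ ≥ 0.8287` on the Fermi curve, `μ` in the certified
window. [folklore] -/
theorem klfs_window_norm_gradient_ge {μ : ℝ} (hμ : μ ∈ Icc (-0.4267 : ℝ) (-0.1798)) {k : Momentum}
    (hk : k ∈ fermiCurve (squareDispersion 1 0) μ) : 0.8287 ≤ ‖gradient (squareDispersion 1 0) k‖ := by
  have he : -2 * (Real.cos (k 0) + Real.cos (k 1)) = μ := by
    have := hk.2; simp [squareDispersion] at this; linarith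
  rw [norm_gradient_squareDispersion]
  exact klfs_window_fermiSpeed_ge hμ he

/-- **`0.0317 ≤ κ ≤ 2.414` on the certified window** (true extremes `0.03182` at the node of `μ = -0.1798`
and `2.4132` at its antinode). [folklore] -/
theorem klfs_window_curvature {μ x y : ℝ} (hμ : μ ∈ Icc (-0.4267 : ℝ) (-0.1798))
    (h : -2 * (Real.cos x + Real.cos y) = μ) :
    (Real.cos x * Real.sin y ^ 2 + Real.cos y * Real.sin x ^ 2) /
        ((Real.sin x ^ 2 + Real.sin y ^ 2) * Real.sqrt (Real.sin x ^ 2 + Real.sin y ^ 2)) ∈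
      Icc (0.0317 : ℝ) 2.414 := by
  obtain ⟨hμ₁, hμ₂⟩ := klfs_window_sub hμ
  have hI := klfs_curvature_mem_Icc (by linarith) hμ₂ h
  constructor
  · refine le_trans ?_ hI.1
    -- `0.0317 · √(32 - 2μ²) ≤ 0.0317 · √32 ≤ 0.1798 ≤ -μ`
    have hs : Real.sqrt (32 - 2 * μ ^ 2) ≤ 5.66 := by
      rw [Real.sqrt_le_left (by norm_num)]; nlinarith
    have hspos : 0 < Real.sqrt (32 - 2 * μ ^ 2) := Real.sqrt_pos.2 (by nlinarith)
    rw [le_div_iff₀ hspos]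
    nlinarith [hμ.2]
  · refine le_trans hI.2 ?_
    have hs : (0.8287 : ℝ) ≤ Real.sqrt (-μ * (4 + μ)) := by
      apply Real.le_sqrt_of_sq_le
      nlinarith [mul_nonpos_iff.2 (Or.inl ⟨sub_nonneg.2 hμ.1, sub_nonpos.2 hμ.2⟩), hμ.1, hμ.2]
    rw [div_le_iff₀ (by linarith)]
    nlinarith

/-- **Nesting defect `≥ 0.3596` on the certified window.** [folklore] -/
theorem klfs_window_nesting_defect {μ : ℝ} (hμ : μ ∈ Icc (-0.4267 : ℝ) (-0.1798)) {k : Fin 2 → ℝ}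
    (hk : sqDispersion k = μ) : 0.3596 ≤ |sqDispersion (fun i => k i + π) - μ| := by
  rw [klfs_nesting_defect hk, abs_of_neg (by linarith [hμ.2])]
  linarith [hμ.2]

/-- **`v_F ≥ 0.7599` on the analysis window `[-1, -0.15]`** (true minimum `√(0.15 · 3.85) = 0.75993…`).
[folklore] -/
theorem klfs_analysisWindow_fermiSpeed_ge {μ x y : ℝ} (hμ : μ ∈ Icc (-1 : ℝ) (-0.15))
    (h : -2 * (Real.cos x + Real.cos y) = μ) : 0.7599 ≤ 2 * Real.sqrt (Real.sin x ^ 2 + Real.sin y ^ 2) := by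
  have hI := (klfs_fermiSpeedSq_mem_Icc h).1
  have hμ2 : (0.7599 : ℝ) ^ 2 ≤ -μ * (4 + μ) := by
    nlinarith [mul_nonpos_iff.2 (Or.inl ⟨sub_nonneg.2 hμ.1, sub_nonpos.2 hμ.2⟩), hμ.1, hμ.2]
  rw [klfs_two_mul_sqrt]
  exact Real.le_sqrt_of_sq_le (hμ2.trans hI)

/-- **`κ ≥ 0.026` on the analysis window `[-1, -0.15]`** (true minimum `0.02653` at the node of
`μ = -0.15`). [folklore] -/
theorem klfs_analysisWindow_curvature_ge {μ x y : ℝ} (hμ : μ ∈ Icc (-1 : ℝ) (-0.15))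
    (h : -2 * (Real.cos x + Real.cos y) = μ) :
    0.026 ≤ (Real.cos x * Real.sin y ^ 2 + Real.cos y * Real.sin x ^ 2) /
        ((Real.sin x ^ 2 + Real.sin y ^ 2) * Real.sqrt (Real.sin x ^ 2 + Real.sin y ^ 2)) := by
  obtain ⟨hμ₁, hμ₂⟩ := klfs_analysisWindow_sub hμ
  have hI := klfs_curvature_mem_Icc (by linarith) hμ₂ h
  refine le_trans ?_ hI.1
  have hs : Real.sqrt (32 - 2 * μ ^ 2) ≤ 5.66 := by
    rw [Real.sqrt_le_left (by norm_num)]; nlinarith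
  have hspos : 0 < Real.sqrt (32 - 2 * μ ^ 2) := Real.sqrt_pos.2 (by nlinarith)
  rw [le_div_iff₀ hspos]
  nlinarith [hμ.2]

end Summit.HubbardSuperconductivity.HubbardSuperconductivity.Theorems

end
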